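import Summits.Langlands.Langlands.Theorems.PicardMuOrdinaryMuOrdinaryFamilyRTPointRoots
import Summits.Langlands.Langlands.Theorems.PicardMuOrdinaryMuOrdinaryFamilyRTPointPolarized

/-!
# The Picard point of line `free-seed-smooth-rt` (crux `MuOrdinaryFamilyRT`, stmt-Langlands-13757):
# LEAF `rbarTraceFrob` — the character of the heart, and Dedekind's theorem for the four roots

Helper file for the registered stub `stub_point` (plan: `…PointPlan.lean`).  PROVED, unconditionally,
`theorem rbarTraceFrob : Leaf.rbarTraceFrob`: for generic `f`, a good prime `𝔭 ∉ S(f)` of `K = ℚ(ζ₃)`, a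
prime `𝔓 ∣ 𝔭` of `\bar ℤ_K` and an arithmetic Frobenius `σ` at `𝔓`,
`tr r̄_f^B(σ) = #{roots of f mod 𝔭 in 𝓞 K ⧸ 𝔭} - 1` in `𝔽₃`.  Ingredients:

* `trace_permRep`, `augmentationConst_eq_bot`, `heartTrace_eq` — **the character of the heart** of a
  permutation module for `p ∤ #Ω`: `tr(π | (𝔽_p^Ω)⁰/𝔽_p 𝟙) = #Fix(π) - 1` (the constants meet the
  sum-zero hyperplane `W` trivially; write the action on `W` as `P ∘ perm(π) ∘ ι` with the equivariant
  projection `P v = v - (ε v/#Ω) 𝟙` and use `tr(P A ι) = tr(A ι P)`, `ι P = id - (1/#Ω) 𝟙 ⊗ ε`);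
* `mem_range_iff_pow_card_eq` — a finite field `k ↪ k'` (`k'` any field) is the set of
  `#k`-th-power-fixed elements;
* **Dedekind** (`ybar_smul`, `ybar_injective`, `C_pow_mul_map_eq_prod`, `eval_fbar_map_eq_zero_iff`,
  `smul_eq_self_iff_mem_range`, `card_fixed_eq_card_roots`): with `y_α = lc(f) α` and `ȳ_α = y_α mod 𝔓`,
  Frobenius gives `ȳ_{σα} = ȳ_α^{N𝔭}`, the `ȳ_α` are distinct (`…PointRoots`), `lc³ f = ∏ (lc X - y_α)`
  so the roots of `f mod 𝔓` are the `ȳ_α / l̄c`, and `σ α = α ↔ ȳ_α ∈ k_𝔭`; hence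
  `#Fix(σ | roots) = #roots(f mod 𝔭)` (the pattern of the route's `fixedCard_perm4_eq`, for `Γ_K`).
-/

-- `Summit.Langlands.Langlands.…` (summit = sub-problem name, D-0017 layout) trips `dupNamespace` on every decl.
set_option linter.dupNamespace false

namespace Summit.Langlands.Langlands.Cruxes.MuOrdinaryFamilyRT.FreeSeedSmoothRt

open scoped NumberField Polynomial Matrix Classical
open Field IsDedekindDomain Polynomial Finset
open Literature.NumberTheory.GaloisRepresentations

noncomputable section

/-! ### The character of the heart: `#Fix - 1` -/

section HeartTrace

variable (p : ℕ) [Fact p.Prime] (Ω : Type) [Fintype Ω]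

/-- The trace of a permutation on the permutation module is its number of fixed points. -/
theorem trace_permRep (π : Equiv.Perm Ω) :
    LinearMap.trace (ZMod p) (Ω →₀ ZMod p) (permRep (ZMod p) (Equiv.Perm Ω) Ω π) =
      ((Finset.univ.filter fun x => π x = x).card : ZMod p) := by
  rw [LinearMap.trace_eq_matrix_trace (ZMod p) (Finsupp.basisSingleOne), Matrix.trace]
  simp only [Matrix.diag_apply, LinearMap.toMatrix_apply, Finsupp.coe_basisSingleOne, permRep_single,
    Finsupp.basisSingleOne_repr, LinearEquiv.refl_apply, Equiv.Perm.smul_def, Finsupp.single_apply]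
  rw [Finset.sum_boole]

/-- For `p ∤ #Ω` the constants meet the augmentation hyperplane trivially. -/
theorem augmentationConst_eq_bot (hp : ¬ p ∣ Fintype.card Ω) : augmentationConst p Ω = ⊥ := by
  rw [eq_bot_iff]
  intro x hx
  obtain ⟨a, ha⟩ := (mem_augmentationConst p Ω).mp hx
  have hx0 : augmentation (ZMod p) Ω (x : Ω →₀ ZMod p) = 0 := (mem_augmentationSubmodule_iff _ _).mp x.2
  rw [← ha, map_smul, constFinsupp, map_sum] at hx0
  simp only [augmentation_single, Finset.sum_const, Finset.card_univ, nsmul_eq_mul, mul_one, smul_eq_mul] at hx0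
  have hcard : (Fintype.card Ω : ZMod p) ≠ 0 := by
    rwa [Ne, ZMod.natCast_eq_zero_iff]
  have ha0 : a = 0 := (mul_eq_zero.mp hx0).resolve_right hcard
  rw [Submodule.mem_bot]
  apply Subtype.ext
  rw [← ha, ha0, zero_smul]
  rfl

/-- The heart representation is conjugate to the augmentation representation when `p ∤ #Ω`. -/
theorem heartTrace_eq_trace_augmentationRep (hp : ¬ p ∣ Fintype.card Ω) (π : Equiv.Perm Ω) :
    heartTrace p Ω π = LinearMap.trace (ZMod p) (augmentationSubmodule (ZMod p) Ω)
      (augmentationRep (ZMod p) (Equiv.Perm Ω) Ω π) := by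
  have hbot := augmentationConst_eq_bot p Ω hp
  rw [heartTrace, ← LinearMap.trace_conj' _ (Submodule.quotEquivOfEqBot _ hbot).symm]
  congr 1
  refine LinearMap.ext fun w => ?_
  obtain ⟨w, rfl⟩ := Submodule.Quotient.mk_surjective _ w
  rw [LinearEquiv.conj_apply_apply, LinearEquiv.symm_symm, Submodule.quotEquivOfEqBot_apply_mk, heartRep_mk,
    Submodule.quotEquivOfEqBot_symm_apply]

/-- **The character of the heart** (`p ∤ #Ω`): `tr(π | heart) = #Fix(π) - 1`.  (Write the
augmentation representation as `P ∘ perm(π) ∘ ι` for the equivariant projection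
`P v = v - (ε v / #Ω) 𝟙` onto the augmentation hyperplane and use `tr(P ∘ A ∘ ι) = tr(A ∘ ι ∘ P)`.) -/
theorem heartTrace_eq (hp : ¬ p ∣ Fintype.card Ω) (π : Equiv.Perm Ω) :
    heartTrace p Ω π = ((Finset.univ.filter fun x => π x = x).card : ZMod p) - 1 := by
  have hc0 : (Fintype.card Ω : ZMod p) ≠ 0 := by rwa [Ne, ZMod.natCast_eq_zero_iff]
  -- the rank-one map `R v = ε(v) 𝟙` and the projection `P = id - R / #Ω` onto `W = ker ε`
  set R : (Ω →₀ ZMod p) →ₗ[ZMod p] (Ω →₀ ZMod p) := (augmentation (ZMod p) Ω).smulRight (constFinsupp p Ω)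
    with hR
  have hε1 : augmentation (ZMod p) Ω (constFinsupp p Ω) = Fintype.card Ω := by
    rw [constFinsupp, map_sum]
    simp only [augmentation_single, Finset.sum_const, Finset.card_univ, nsmul_eq_mul, mul_one]
  set Q : (Ω →₀ ZMod p) →ₗ[ZMod p] (Ω →₀ ZMod p) := LinearMap.id - (Fintype.card Ω : ZMod p)⁻¹ • R with hQ
  have hQapply : ∀ v, Q v = v - (Fintype.card Ω : ZMod p)⁻¹ • (augmentation (ZMod p) Ω v • constFinsupp p Ω) :=
    fun v => rfl
  have hPmem : ∀ v, Q v ∈ augmentationSubmodule (ZMod p) Ω := fun v => by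
    rw [mem_augmentationSubmodule_iff, hQapply, map_sub, map_smul, map_smul, hε1, smul_eq_mul, smul_eq_mul,
      mul_comm, mul_assoc, mul_inv_cancel₀ hc0, mul_one, sub_self]
  set P : (Ω →₀ ZMod p) →ₗ[ZMod p] augmentationSubmodule (ZMod p) Ω := LinearMap.codRestrict _ Q hPmem with hP
  have hPι : ∀ w : augmentationSubmodule (ZMod p) Ω, P (w : Ω →₀ ZMod p) = w := fun w => by
    apply Subtype.ext
    rw [hP, LinearMap.codRestrict_apply, hQapply, (mem_augmentationSubmodule_iff _ _).mp w.2, zero_smul,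
      smul_zero, sub_zero]
  have haug : augmentationRep (ZMod p) (Equiv.Perm Ω) Ω π =
      P ∘ₗ (permRep (ZMod p) (Equiv.Perm Ω) Ω π ∘ₗ (augmentationSubmodule (ZMod p) Ω).subtype) := by
    refine LinearMap.ext fun w => ?_
    rw [LinearMap.comp_apply, LinearMap.comp_apply, Submodule.subtype_apply]
    have := hPι (augmentationRep (ZMod p) (Equiv.Perm Ω) Ω π w)
    rw [coe_augmentationRep_apply] at this
    exact this.symm
  have hιP : (augmentationSubmodule (ZMod p) Ω).subtype ∘ₗ P = Q :=
    LinearMap.ext fun v => by rw [LinearMap.comp_apply, Submodule.subtype_apply, hP, LinearMap.codRestrict_apply]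
  have hπR : permRep (ZMod p) (Equiv.Perm Ω) Ω π ∘ₗ R = R := by
    refine LinearMap.ext fun v => ?_
    rw [LinearMap.comp_apply, hR, LinearMap.smulRight_apply, map_smul, permRep_constFinsupp]
  rw [heartTrace_eq_trace_augmentationRep p Ω hp, haug, LinearMap.trace_comp_comm', LinearMap.comp_assoc, hιP, hQ,
    LinearMap.comp_sub, LinearMap.comp_id, LinearMap.comp_smul, hπR]
  have h2 := (LinearMap.trace (ZMod p) (Ω →₀ ZMod p)).map_sub (permRep (ZMod p) (Equiv.Perm Ω) Ω π)
    ((Fintype.card Ω : ZMod p)⁻¹ • R)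
  rw [LinearMap.map_smul, trace_permRep, hR, LinearMap.trace_smulRight, hε1, smul_eq_mul,
    inv_mul_cancel₀ hc0] at h2
  convert h2 using 2

end HeartTrace

/-! ### Finite fields inside a field: the image is the set of `q`-th-power-fixed elements -/

/-- For a finite field `k` with `q` elements embedded by `ι` in a field `k'`:
`x ∈ range ι ↔ x ^ q = x` (`X^q - X` has at most `q` roots in `k'`, all supplied by `ι(k)`). -/
theorem mem_range_iff_pow_card_eq {k k' : Type*} [Field k] [Finite k] [Field k'] (ι : k →+* k') (x : k') :
    x ∈ Set.range ι ↔ x ^ Nat.card k = x := by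
  haveI := Fintype.ofFinite k
  rw [Nat.card_eq_fintype_card]
  constructor
  · rintro ⟨a, rfl⟩
    rw [← map_pow, FiniteField.pow_card]
  · intro hx
    have hq1 : 1 < Fintype.card k := Fintype.one_lt_card
    have hne : (X ^ Fintype.card k - X : k'[X]) ≠ 0 := FiniteField.X_pow_card_sub_X_ne_zero k' hq1
    set S : Finset k' := (X ^ Fintype.card k - X : k'[X]).roots.toFinset with hS
    set T : Finset k' := Finset.univ.image ι with hT
    have hmemS : ∀ z : k', z ∈ S ↔ z ^ Fintype.card k = z := fun z => by
      rw [hS, Multiset.mem_toFinset, mem_roots hne, IsRoot, eval_sub, eval_pow, eval_X, sub_eq_zero]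
    have hTS : T ⊆ S := by
      intro z hz
      obtain ⟨a, -, rfl⟩ := Finset.mem_image.mp hz
      rw [hmemS, ← map_pow, FiniteField.pow_card]
    have hTcard : T.card = Fintype.card k := by
      rw [hT, Finset.card_image_of_injective _ ι.injective, Finset.card_univ]
    have hScard : S.card ≤ Fintype.card k := by
      calc S.card ≤ Multiset.card (X ^ Fintype.card k - X : k'[X]).roots := Multiset.toFinset_card_le _
        _ ≤ (X ^ Fintype.card k - X : k'[X]).natDegree := card_roots' _
        _ = Fintype.card k := FiniteField.X_pow_card_sub_X_natDegree_eq k' hq1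
    have hST : T = S := Finset.eq_of_subset_of_card_le hTS (by rw [hTcard]; exact hScard)
    have hxS : x ∈ S := (hmemS x).mpr hx
    rw [← hST, hT, Finset.mem_image] at hxS
    obtain ⟨a, -, rfl⟩ := hxS
    exact ⟨a, rfl⟩

/-! ### Dedekind: fixed points of Frobenius on the roots = roots of `f mod 𝔭` in `k_𝔭` -/

section Dedekind

-- residue rings of maximal ideals are fields (Mathlib keeps this a `def` to avoid diamonds)
attribute [local instance] Ideal.Quotient.field

variable {f : ℤ[X]} (hgen : Generic f) {𝔭 : HeightOneSpectrum (𝓞 K)} (h𝔭 : 𝔭 ∉ badPrimes f)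
  {𝔓 : Ideal (absIntegers (𝓞 K) K)} (h𝔓 : 𝔓 ∈ 𝔭.primesAbove)

/-- `f mod 𝔭` over `k_𝔭 = 𝓞 K ⧸ 𝔭` (verbatim the polynomial of `Leaf.rbarTraceFrob`). -/
abbrev fbar (f : ℤ[X]) (𝔭 : HeightOneSpectrum (𝓞 K)) : (𝓞 K ⧸ 𝔭.asIdeal)[X] :=
  f.map ((Ideal.Quotient.mk 𝔭.asIdeal).comp (algebraMap ℤ (𝓞 K)))

include h𝔓 in
/-- `𝔭 ≤ 𝔓 ∩ 𝓞 K`. -/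
theorem asIdeal_le_comap : 𝔭.asIdeal ≤ 𝔓.comap (algebraMap (𝓞 K) (absIntegers (𝓞 K) K)) :=
  h𝔓.2.over.le

/-- The residue field embedding `ι : k_𝔭 → \bar ℤ_K ⧸ 𝔓`. -/
def iota : 𝓞 K ⧸ 𝔭.asIdeal →+* absIntegers (𝓞 K) K ⧸ 𝔓 :=
  Ideal.quotientMap 𝔓 (algebraMap (𝓞 K) (absIntegers (𝓞 K) K)) (asIdeal_le_comap h𝔓)

include h𝔓 in
/-- `𝔓` is maximal (it lies over the maximal ideal `𝔭` in an integral extension). -/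
theorem isMaximal_of_mem_primesAbove : 𝔓.IsMaximal := by
  haveI := h𝔓.1
  haveI := h𝔓.2
  haveI := 𝔭.isMaximal
  exact Ideal.IsMaximal.of_liesOver_isMaximal 𝔓 𝔭.asIdeal

/-- `ι` is injective. -/
theorem iota_injective : Function.Injective (iota h𝔓) := by
  haveI := 𝔭.isMaximal
  haveI := isMaximal_of_mem_primesAbove h𝔓
  exact (iota h𝔓).injective

include h𝔓 in
/-- An integer lies in `𝔓` iff it lies in `𝔭`. -/
theorem intCast_mem_iff (n : ℤ) : (n : absIntegers (𝓞 K) K) ∈ 𝔓 ↔ (n : 𝓞 K) ∈ 𝔭.asIdeal := by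
  rw [h𝔓.2.over, Ideal.mem_under, map_intCast]

/-- The reduced integral roots `ȳ_α = y_α mod 𝔓`. -/
def ybar (α : Roots f) : absIntegers (𝓞 K) K ⧸ 𝔓 := Ideal.Quotient.mk 𝔓 (yInt α)

include h𝔓 in
/-- **Frobenius**: `ȳ_{σ α} = ȳ_α ^ q`, `q = #k_𝔭`, for an arithmetic Frobenius `σ` at `𝔓`. -/
theorem ybar_smul {σ : absoluteGaloisGroup K} (hσ : IsArithFrobAt (𝓞 K) σ 𝔓) (α : Roots f) :
    ybar (𝔓 := 𝔓) (σ • α) = ybar (𝔓 := 𝔓) α ^ Nat.card (𝓞 K ⧸ 𝔭.asIdeal) := by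
  rw [ybar, ybar, ← smul_yInt, h𝔓.2.over]
  exact hσ.mk_apply (yInt α)

include hgen h𝔭 h𝔓 in
/-- The `ȳ_α` are pairwise distinct (`𝔭 ∉ S(f)`). -/
theorem ybar_injective : Function.Injective (ybar (𝔓 := 𝔓) : Roots f → _) := fun α β hαβ => by
  by_contra hne
  exact yInt_sub_notMem hgen h𝔭 h𝔓 (Ne.symm hne) (Ideal.Quotient.eq.mp hαβ)

include h𝔭 h𝔓 in
/-- `lc(f) ∉ 𝔓`. -/
theorem leadingCoeff_notMem : ((f.leadingCoeff : ℤ) : absIntegers (𝓞 K) K) ∉ 𝔓 := by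
  rw [intCast_mem_iff h𝔓]
  intro h
  apply h𝔭
  change ((3 * f.discr * f.leadingCoeff : ℤ) : 𝓞 K) ∈ 𝔭.asIdeal
  rw [Int.cast_mul]
  exact 𝔭.asIdeal.mul_mem_left _ h

/-- **`lc(f)³ · f = ∏ (lc(f) X - y_α)` over `\bar ℤ_K`** (checked in `K̄[X]`). -/
theorem C_pow_mul_map_eq_prod :
    C ((f.leadingCoeff : ℤ) : absIntegers (𝓞 K) K) ^ 3 * f.map (algebraMap ℤ (absIntegers (𝓞 K) K)) =
      ∏ i : Fin 4, (C ((f.leadingCoeff : ℤ) : absIntegers (𝓞 K) K) * X - C (yInt (rootEnum hgen i))) := by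
  apply Polynomial.map_injective (algebraMap (absIntegers (𝓞 K) K) (AlgebraicClosure K)) Subtype.val_injective
  rw [Polynomial.map_mul, Polynomial.map_pow, map_C, Polynomial.map_map,
    RingHom.ext_int ((algebraMap (absIntegers (𝓞 K) K) (AlgebraicClosure K)).comp (algebraMap ℤ _))
      (algebraMap ℤ (AlgebraicClosure K)), Polynomial.map_prod, map_eq_splitQuartic hgen]
  simp only [Polynomial.map_sub, Polynomial.map_mul, map_C, map_X]
  set c : AlgebraicClosure K := ((f.leadingCoeff : ℤ) : AlgebraicClosure K) with hc
  set α : Fin 4 → AlgebraicClosure K := fun i => ((rootEnum hgen i : Roots f) : AlgebraicClosure K) with hα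
  have hlhs : (algebraMap (absIntegers (𝓞 K) K) (AlgebraicClosure K)) ((f.leadingCoeff : ℤ) : absIntegers (𝓞 K) K) = c := by
    rw [map_intCast]
  have hfac : ∀ i : Fin 4, C c * X - C ((algebraMap (absIntegers (𝓞 K) K) (AlgebraicClosure K)) (yInt (rootEnum hgen i))) =
      C c * (X - C (α i)) := fun i => by
    rw [show (algebraMap (absIntegers (𝓞 K) K) (AlgebraicClosure K)) (yInt (rootEnum hgen i)) = c * α i from rfl,
      C_mul, mul_sub]
  simp only [hlhs, hfac]
  rw [Finset.prod_mul_distrib, Finset.prod_const, Finset.card_univ, Fintype.card_fin,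
    Summit.Langlands.Langlands.Theorems.ResidualAutomorphyEven.splitQuartic,
    Summit.Langlands.Langlands.Theorems.ResidualAutomorphyEven.prodFour, Fin.prod_univ_four]
  ring

/-- `lc(f) mod 𝔓`. -/
def lcbar : absIntegers (𝓞 K) K ⧸ 𝔓 := Ideal.Quotient.mk 𝔓 ((f.leadingCoeff : ℤ) : absIntegers (𝓞 K) K)

include h𝔭 h𝔓 in
/-- `lc(f) mod 𝔓 ≠ 0`. -/
theorem lcbar_ne_zero : lcbar (f := f) (𝔓 := 𝔓) ≠ 0 := by
  rw [lcbar, Ne, Ideal.Quotient.eq_zero_iff_mem]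
  exact leadingCoeff_notMem h𝔭 h𝔓

/-- `(f mod 𝔭) ⊗ (\bar ℤ_K ⧸ 𝔓) = f mod 𝔓`. -/
theorem fbar_map_iota :
    (fbar f 𝔭).map (iota h𝔓) = (f.map (algebraMap ℤ (absIntegers (𝓞 K) K))).map (Ideal.Quotient.mk 𝔓) := by
  rw [Polynomial.map_map, Polynomial.map_map]
  exact congrArg (Polynomial.map · f) (RingHom.ext_int _ _)

/-- **The reduced identity `l̄c³ · (f mod 𝔓) = ∏ (l̄c X - ȳᵢ)`.** -/
theorem C_lcbar_pow_mul_eq_prod :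
    C (lcbar (f := f) (𝔓 := 𝔓)) ^ 3 * (fbar f 𝔭).map (iota h𝔓) =
      ∏ i : Fin 4, (C (lcbar (f := f) (𝔓 := 𝔓)) * X - C (ybar (rootEnum hgen i))) := by
  rw [fbar_map_iota]
  have := congrArg (Polynomial.map (Ideal.Quotient.mk 𝔓)) (C_pow_mul_map_eq_prod hgen)
  rw [Polynomial.map_mul, Polynomial.map_pow, map_C, Polynomial.map_prod] at this
  simp only [Polynomial.map_sub, Polynomial.map_mul, map_C, map_X] at this
  exact this

include h𝔭 in
/-- Roots of `f mod 𝔓`: `(f mod 𝔭)(z) = 0` iff `l̄c z` is one of the `ȳᵢ`. -/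
theorem eval_fbar_map_eq_zero_iff (z : absIntegers (𝓞 K) K ⧸ 𝔓) :
    ((fbar f 𝔭).map (iota h𝔓)).eval z = 0 ↔ ∃ i : Fin 4, ybar (rootEnum hgen i) = lcbar (f := f) (𝔓 := 𝔓) * z := by
  haveI := isMaximal_of_mem_primesAbove h𝔓
  have key := congrArg (Polynomial.eval z) (C_lcbar_pow_mul_eq_prod hgen h𝔓)
  simp only [eval_mul, eval_pow, eval_C, eval_prod, eval_sub, eval_X] at key
  constructor
  · intro hz
    rw [hz, mul_zero] at key
    obtain ⟨i, -, hi⟩ := Finset.prod_eq_zero_iff.mp key.symm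
    exact ⟨i, (sub_eq_zero.mp hi).symm⟩
  · rintro ⟨i, hi⟩
    have h0 : ∏ i : Fin 4, (lcbar (f := f) (𝔓 := 𝔓) * z - ybar (rootEnum hgen i)) = 0 :=
      Finset.prod_eq_zero (Finset.mem_univ i) (by rw [hi, sub_self])
    rw [h0, mul_eq_zero] at key
    exact key.resolve_left (pow_ne_zero _ (lcbar_ne_zero h𝔭 h𝔓))

include hgen h𝔭 in
/-- `f mod 𝔭 ≠ 0` (its `X⁴`-coefficient is `lc(f) mod 𝔭 ≠ 0`). -/
theorem fbar_ne_zero : fbar f 𝔭 ≠ 0 := by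
  intro h0
  have h4 := congrArg (fun p : (𝓞 K ⧸ 𝔭.asIdeal)[X] => p.coeff 4) h0
  simp only [coeff_map, coeff_zero, RingHom.comp_apply] at h4
  rw [← hgen.1, coeff_natDegree, Ideal.Quotient.eq_zero_iff_mem, eq_intCast] at h4
  apply h𝔭
  change ((3 * f.discr * f.leadingCoeff : ℤ) : 𝓞 K) ∈ 𝔭.asIdeal
  rw [Int.cast_mul]
  exact 𝔭.asIdeal.mul_mem_left _ h4

include hgen h𝔭 in
/-- **Fixed points of Frobenius ↔ reduced roots in `k_𝔭`** (Dedekind): `σ α = α` iff `ȳ_α ∈ ι(k_𝔭)`. -/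
theorem smul_eq_self_iff_mem_range {σ : absoluteGaloisGroup K} (hσ : IsArithFrobAt (𝓞 K) σ 𝔓) (α : Roots f) :
    σ • α = α ↔ ybar (𝔓 := 𝔓) α ∈ Set.range (iota h𝔓) := by
  haveI := 𝔭.isMaximal
  haveI := isMaximal_of_mem_primesAbove h𝔓
  rw [← (ybar_injective hgen h𝔭 h𝔓).eq_iff, ybar_smul h𝔓 hσ, mem_range_iff_pow_card_eq]

include hgen h𝔭 h𝔓 in
/-- **`#Fix(σ | roots of f) = #roots of (f mod 𝔭) in k_𝔭`** for an arithmetic Frobenius `σ` at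
`𝔓 ∣ 𝔭`, `𝔭 ∉ S(f)`: both sets are in bijection with `{ȳ_α} ∩ l̄c · ι(k_𝔭)`. -/
theorem card_fixed_eq_card_roots {σ : absoluteGaloisGroup K} (hσ : IsArithFrobAt (𝓞 K) σ 𝔓) :
    (Finset.univ.filter fun α : Roots f => σ • α = α).card = (fbar f 𝔭).roots.toFinset.card := by
  haveI := 𝔭.isMaximal
  haveI := isMaximal_of_mem_primesAbove h𝔓
  have hinj := iota_injective h𝔓
  have hy := ybar_injective hgen h𝔭 h𝔓
  have hl := lcbar_ne_zero (f := f) h𝔭 h𝔓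
  have hfbar0 := fbar_ne_zero hgen h𝔭
  set lv : 𝓞 K ⧸ 𝔭.asIdeal := Ideal.Quotient.mk 𝔭.asIdeal ((f.leadingCoeff : ℤ) : 𝓞 K) with hlv
  have hlι : iota h𝔓 lv = lcbar (f := f) (𝔓 := 𝔓) := by
    rw [hlv, iota, Ideal.quotientMap_mk, lcbar, map_intCast]
  have hlv0 : lv ≠ 0 := fun h0 => hl (by rw [← hlι, h0, map_zero])
  set A := (fbar f 𝔭).roots.toFinset with hA
  set B := Finset.univ.filter fun α : Roots f => σ • α = α with hB
  have hmemA : ∀ y, y ∈ A ↔ ((fbar f 𝔭).map (iota h𝔓)).eval (iota h𝔓 y) = 0 := fun y => by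
    rw [eval_map, eval₂_hom, map_eq_zero_iff _ hinj, hA, Multiset.mem_toFinset, mem_roots hfbar0, IsRoot.def]
  have himg : A.image (fun y => lcbar (f := f) (𝔓 := 𝔓) * iota h𝔓 y) = B.image (ybar (𝔓 := 𝔓)) := by
    ext z
    simp only [Finset.mem_image, hB, Finset.mem_filter, Finset.mem_univ, true_and]
    constructor
    · rintro ⟨y, hyA, rfl⟩
      obtain ⟨i, hi⟩ := (eval_fbar_map_eq_zero_iff hgen h𝔭 h𝔓 _).mp ((hmemA y).mp hyA)
      refine ⟨rootEnum hgen i, (smul_eq_self_iff_mem_range hgen h𝔭 h𝔓 hσ _).mpr ⟨lv * y, ?_⟩, hi⟩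
      rw [map_mul, hlι, hi]
    · rintro ⟨α, hα, rfl⟩
      obtain ⟨t, ht⟩ := (smul_eq_self_iff_mem_range hgen h𝔭 h𝔓 hσ α).mp hα
      refine ⟨lv⁻¹ * t, ?_, ?_⟩
      · rw [hmemA]
        refine (eval_fbar_map_eq_zero_iff hgen h𝔭 h𝔓 _).mpr ⟨(rootEnum hgen).symm α, ?_⟩
        rw [Equiv.apply_symm_apply, map_mul, map_inv₀, hlι, ht, mul_inv_cancel_left₀ hl]
      · rw [map_mul, map_inv₀, hlι, ht, mul_inv_cancel_left₀ hl]
  have hcardA : (A.image fun y => lcbar (f := f) (𝔓 := 𝔓) * iota h𝔓 y).card = A.card :=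
    Finset.card_image_of_injective _ fun y₁ y₂ h => hinj (mul_left_cancel₀ hl h)
  have hcardB : (B.image (ybar (𝔓 := 𝔓))).card = B.card := Finset.card_image_of_injective _ hy
  rw [← hcardB, ← himg, hcardA]

end Dedekind

/-! ### LEAF `rbarTraceFrob` -/

/-- **LEAF `rbarTraceFrob`** (registered helper goal of `stub_point`): `tr r̄_f^B(Frob_𝔓) =
#{roots of f mod 𝔭} - 1` in `𝔽₃` for `𝔭 ∉ S(f)`. -/
theorem rbarTraceFrob : Leaf.rbarTraceFrob := by
  intro f B hgen 𝔭 h𝔭 𝔓 h𝔓 σ hσ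
  have h3 : ¬ 3 ∣ Fintype.card (Roots f) := by rw [card_roots hgen]; decide
  rw [trace_rbar_eq_heartTrace, heartTrace_eq 3 (Roots f) h3, ← card_fixed_eq_card_roots hgen h𝔭 h𝔓 hσ]
  simp only [MulAction.toPerm_apply]

end

end Summit.Langlands.Langlands.Cruxes.MuOrdinaryFamilyRT.FreeSeedSmoothRt
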